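import Summits.QuantumFields.YangMills.Theorems.BalabanUVNodesN15FullPropagatorEntry2Defect
import HarnessLib

/-!
# Route «BalabanUVNodes» (K4 «SpineRates»), node N15 = NE2, BACKGROUND LAYER — THE SCALAR FIRST-ORDER SPECIES IN BY-PARTS FORM: `W = V̂∘Ĝ` IS the right perturbation,
# `hE0` for n15-b's `bgPair`, the IDENTIFICATION `pr₀(bgPair G D c a)∘∇_ν* = E₂∘ι_ν`, and the multiplier ∕ coefficient ∕ intertwiner LETTERS from six scalar coefficient letters

Cell `pub-ymgap`, seat `pub-ymgap-dag-n15-c` (generation g8; R134 ACCELERATION SEAT, strategy s1; HUMAN RULING D-0062; chair R424 venue; `bears_on: R4∕N15`).  Filed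
`--kind proof --supports stmt-QuantumFields-20509 --as helper` (K3⁶; count-neutral).  Imports BY NAME this seat's `…N15FullPropagatorEntry2Defect` (FILE 5: `projO_bgPropV_fix_right`;
through it FILES 1–4: `rightPert`, `byPartsMult`, `byPartsFactor`, `smul_mulOp_sub_eq`, `mulOp_comp_pull`, `e0_comp_fgradAdj_eq_e2ByParts`, `e2ByParts`, `bopOf`, `krowOf`, `E2Unit`)
and, through it, n15-b's B2 `…N15BackgroundPairSpace` (`stack`, `unstack`, `bgPair`, `projO`); [B6]'s coefficient-defect lemmas `T4EtaRateCoeffDefect.hasMaj_mulOp` ∕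
`hasMaj_idef_mulOp`; nothing in the tree is modified.

WHY.  The by-parts device (FILES 1–5) is stated for abstract coefficient OPERATORS `C^a_μ, C^b_μ` and their translates.  The lineage's first-order background species is
n15-b's SCALAR one, `V̂ = unstack c a = M_c∘pr₀ + Σ_μ M_{a_μ}∘pr_μ` ((3.52) with forward coefficients; carrier `coeffBg₁`), dressed pair `bgPair G D c a = (1 − ĜV̂)⁻¹Ĝ`.  THIS
FILE specialises the device to it: (§1) `W = V̂∘stack G D = M_cG + Σ_μM_{a_μ}∇_μG = rightPert τ n G M_c (M_{a_μ}) 0` when the derived pieces ARE the forward derivatives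
(`unstack_comp_stack_eq_rightPert`), hence ★ `projO_bgPair_fix_right` (the `hE0` of FILE 1∕2 for the lineage's OWN dressed entry 0) and ★★ `e0_comp_fgradAdj_eq_e2ByParts_scalar`
(the by-parts entry-2 object with multiplier `M_{c − Σ_μ(∇_μa_μ)∘e_μ⁻¹}` and rows `S_μM_{a_μ∘e_μ⁻¹}` IS `pr₀(bgPair G D c a)∘∇_ν*`); (§2) the displayed multiplier ∕ coefficient ∕
intertwiner hypotheses of FILE 5's ★★ from SIX SCALAR LETTERS of the coefficients — sup `r`, the GRADIENT letter `|∇_μa_μ| ≤ r₁` (the unit-scale reading of (3.35)'s `|∂A|`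
bound; it makes the by-parts multiplier bounded and gives the one-step oscillation `r₁∕n`), and the fits `o` of `c`, of the translated `a_μ∘e_μ⁻¹` and of the translated
DERIVATIVES `(∇_μa_μ)∘e_μ⁻¹` against their coarse partners through `π` (the last one is the (3.36)-type second-difference content).

CONTENTS ([folklore] algebra + bookkeeping; 0 def).
* §1 `mulOp_sub`, `mulOp_sum`, `pull_comp_mulOp_translate`, `byPartsMult_scalar`, `byPartsFactor_scalar`, `unstack_comp_stack_eq_rightPert`, ★ `projO_bgPair_fix_right`,
  ★★ `e0_comp_fgradAdj_eq_e2ByParts_scalar`.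
* §2 `hasMaj_mulOp_translate`, `hasMaj_byPartsMult_scalar` (`diagK (r + |J|r₁)`), `hasMaj_idef_byPartsMult_scalar` (`diagK (o + |J|o)`), `hasMaj_idef_mulOp_translate`, `hasMaj_zero_diagK`,
  `hasMaj_idef_zero_diagK`, `pull_comp_mulOp_translate'` (the coarse shift intertwiner, `C^{a+}_μ = M_{a_μ}`), `hasMaj_mulOp_sub_translate` (`diagK o₁`), `osc_of_fgrad` (`o₁ = r₁∕n`).

HONEST FRAMING ∕ LIMITS.  Algebra and letter bookkeeping over abstract lattices; the six scalar letters are DISPLAYED (reading them off a (3.35)–(3.36)-type carrier on the torus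
family — block averages, King's pairing — is the next file); nothing about Bałaban's `G(U)` asserted.  NE2⁺ NOT PRINTED, NOT proved, not claimed; count-neutral (typed 28∕28 ·
discharged 5∕27 of record unchanged); N15 NOT discharged; one finite lattice at fixed ε — NOT ℝ⁴, NOT infinite volume, NOT OS, NOT a mass gap, NOT Clay.
-/

noncomputable section

open scoped BigOperators
open Finset

namespace Summit.QuantumFields.YangMills.BalabanUVNodes.N15.BackgroundLayer

open Literature.MathematicalPhysics.QuantumFieldTheory.Balaban1983to89
open Literature.MathematicalPhysics.QuantumFieldTheory.Balaban1983to89.B11SectG (BlockNorm HasMaj hasMaj_zero)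
open Literature.MathematicalPhysics.QuantumFieldTheory.Balaban1983to89.T4EtaRateDefect (idef idef_apply idef_zero)
open Literature.MathematicalPhysics.QuantumFieldTheory.Balaban1983to89.T4EtaRateCoeffDefect (pull pull_apply diagK diagK_nonneg hasMaj_mulOp hasMaj_idef_mulOp)
open Literature.MathematicalPhysics.QuantumFieldTheory.Balaban1983to89.B6Prop26Gluing (mulOp mulOp_apply)

/-! ## §1 The SCALAR first-order species in by-parts form: algebra -/

section Algebra

variable {X J : Type} [Fintype J] [DecidableEq J]

/-- `M_{f − g} = M_f − M_g`. [folklore] -/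
theorem mulOp_sub (f g : X → ℝ) : mulOp (f - g) = mulOp f - mulOp g := by
  refine LinearMap.ext fun v => funext fun x => ?_
  simp only [mulOp_apply, Pi.sub_apply, LinearMap.sub_apply]
  ring

omit [DecidableEq J] in
/-- `M_{Σ_μ f_μ} = Σ_μ M_{f_μ}`. [folklore] -/
theorem mulOp_sum (f : J → X → ℝ) : mulOp (∑ μ, f μ) = ∑ μ, mulOp (f μ) := by
  refine LinearMap.ext fun v => funext fun x => ?_
  simp only [mulOp_apply, Finset.sum_apply, LinearMap.sum_apply, Finset.sum_mul]

/-- the shift intertwines a translated coefficient back: `S_e ∘ M_{a∘e⁻¹} = M_a ∘ S_e`. [folklore] -/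
theorem pull_comp_mulOp_translate (a : X → ℝ) (e : X ≃ X) : pull ⇑e ∘ₗ mulOp (a ∘ ⇑e.symm) = mulOp a ∘ₗ pull ⇑e := by
  refine LinearMap.ext fun f => funext fun x => ?_
  simp only [LinearMap.comp_apply, pull_apply, mulOp_apply, Function.comp_apply, Equiv.symm_apply_apply]

variable (τ : J → X ≃ X) (n : ℝ) (G : (X → ℝ) →ₗ[ℝ] (X → ℝ)) (c : X → ℝ) (a : J → X → ℝ)

omit [DecidableEq J] in
/-- THE BY-PARTS MULTIPLIER OF THE SCALAR SPECIES is the multiplication by ONE function: `R̃ = M_{c − Σ_μ (∇_μa_μ)∘e_μ⁻¹}`. [folklore] -/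
theorem byPartsMult_scalar :
    byPartsMult n (mulOp c) (fun μ => mulOp (a μ)) (fun μ => mulOp (a μ ∘ ⇑(τ μ).symm)) (fun _ => 0) (fun _ => 0) =
      mulOp (c - ∑ μ, fgrad n (τ μ) (a μ) ∘ ⇑(τ μ).symm) := by
  rw [byPartsMult, mulOp_sub, mulOp_sum]
  congr 1
  refine Finset.sum_congr rfl fun μ _ => ?_
  rw [sub_zero, add_zero, smul_mulOp_sub_eq]

omit [Fintype J] [DecidableEq J] in
/-- THE BY-PARTS ROWS OF THE SCALAR SPECIES: `K̃_μ = S_μ ∘ M_{a_μ∘e_μ⁻¹}` (no backward coefficient). [folklore] -/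
theorem byPartsFactor_scalar (μ : J) :
    byPartsFactor τ (fun μ => mulOp (a μ ∘ ⇑(τ μ).symm)) (fun _ => 0) μ = pull ⇑(τ μ) ∘ₗ mulOp (a μ ∘ ⇑(τ μ).symm) + 0 := rfl

omit [DecidableEq J] in
/-- THE RIGHT PERTURBATION OF THE SCALAR SPECIES IS n15-b's UNSTACKED PERTURBATION AFTER THE STACK: `W = V̂∘Ĝ = M_cG + Σ_μ M_{a_μ}∇_μG` when the derived pieces ARE the
forward derivatives of the piece. [cite: Balaban1985BackgroundPropagators, (3.52) p.400, (3.63)–(3.64) p.402 (shapes)] -/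
theorem unstack_comp_stack_eq_rightPert {D : J → (X → ℝ) →ₗ[ℝ] (X → ℝ)} (hD : ∀ μ, D μ = fgrad n (τ μ) ∘ₗ G) :
    unstack c a ∘ₗ stack G D = rightPert τ n G (mulOp c) (fun μ => mulOp (a μ)) (fun _ => 0) := by
  rw [rightPert]
  refine LinearMap.ext fun v => funext fun x => ?_
  simp only [LinearMap.comp_apply, unstack_apply, stack_apply_none, stack_apply_some, LinearMap.add_apply, LinearMap.sum_apply, Finset.sum_apply,
    Pi.add_apply, mulOp_apply, LinearMap.zero_comp, add_zero, hD]

variable [Fintype X] [DecidableEq X]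

/-- ★ **`hE0` FOR THE LINEAGE's SCALAR FIRST-ORDER PAIR**: the dressed entry 0 `E₀ = pr₀X̂`, `X̂ = bgPair G D c a` (n15-b B2), solves the RIGHT fixed-point equation of
`…TupleCalculus.e2_closed_system` with the scalar species data, whenever the derived pieces are the forward derivatives of `G` and `1 − [ĜV̂]` is a unit.
[cite: Balaban1985BackgroundPropagators, (3.64)–(3.65) p.402 (mechanism)] -/
theorem projO_bgPair_fix_right {D : J → (X → ℝ) →ₗ[ℝ] (X → ℝ)} (hD : ∀ μ, D μ = fgrad n (τ μ) ∘ₗ G)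
    (hunit : IsUnit (1 - LinearMap.toMatrix' (stack G D ∘ₗ unstack c a))) :
    projO none ∘ₗ bgPair G D c a = G + (projO none ∘ₗ bgPair G D c a) ∘ₗ rightPert τ n G (mulOp c) (fun μ => mulOp (a μ)) (fun _ => 0) := by
  rw [← unstack_comp_stack_eq_rightPert τ n G c a hD, bgPair]
  exact projO_bgPropV_fix_right hunit

/-- ★★ **IDENTIFICATION FOR THE SCALAR SPECIES**: under the unit hypotheses, the by-parts entry-2 object built on `S_ν = G∇_ν*`, `E₀ = pr₀(bgPair G D c a)`, the multiplier
`M_{c − Σ(∇a)∘e⁻¹}` and the rows `S_μM_{a_μ∘e⁻¹}` IS `E₀∘∇_ν*` — the dressed propagator of the lineage composed with `∇_ν*`. [cite: Balaban1985BackgroundPropagators, (3.64)–(3.65) p.402 (mechanism); by-parts form ours] -/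
theorem e0_comp_fgradAdj_eq_e2ByParts_scalar {D : J → (X → ℝ) →ₗ[ℝ] (X → ℝ)} (hD : ∀ μ, D μ = fgrad n (τ μ) ∘ₗ G)
    (hunit : IsUnit (1 - LinearMap.toMatrix' (stack G D ∘ₗ unstack c a)))
    (hunit2 : E2Unit (krowOf (fun ν => G ∘ₗ fgradAdj n (τ ν)) (fun μ => pull ⇑(τ μ)) (fun μ => mulOp (a μ ∘ ⇑(τ μ).symm)) (fun _ => 0))) (ν : J) :
    (projO none ∘ₗ bgPair G D c a) ∘ₗ fgradAdj n (τ ν) =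
      e2ByParts (bopOf (fun ν => G ∘ₗ fgradAdj n (τ ν)) (projO none ∘ₗ bgPair G D c a) (mulOp (c - ∑ μ, fgrad n (τ μ) (a μ) ∘ ⇑(τ μ).symm)))
        (krowOf (fun ν => G ∘ₗ fgradAdj n (τ ν)) (fun μ => pull ⇑(τ μ)) (fun μ => mulOp (a μ ∘ ⇑(τ μ).symm)) (fun _ => 0)) ∘ₗ injJ ν := by
  rw [← byPartsMult_scalar τ n c a]
  exact e0_comp_fgradAdj_eq_e2ByParts (projO_bgPair_fix_right τ n G c a hD hunit) (fun μ => mulOp_comp_pull (a μ) (τ μ))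
    (fun μ => by rw [LinearMap.zero_comp, LinearMap.comp_zero]) hunit2 ν

end Algebra

/-! ## §2 The letters of the scalar by-parts data from six scalar coefficient letters -/

section Letters

variable {X X' J : Type} [Fintype X] [Fintype X'] [Fintype J] [DecidableEq J] {g : B6.Geometry} (blk : X → g.Site) (π : X' → X)
variable {τ : J → X ≃ X} {τ' : J → X' ≃ X'} {n n' : ℝ} {c : X → ℝ} {a : J → X → ℝ} {c' : X' → ℝ} {a' : J → X' → ℝ} {r r₁ o o₁ : ℝ}

omit [Fintype X'] [Fintype J] [DecidableEq J] in
/-- translated coefficient: `M_{a∘e⁻¹} ≤ diagK r` from `|a| ≤ r`. [folklore] -/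
theorem hasMaj_mulOp_translate (hr : 0 ≤ r) (ha : ∀ μ x, |a μ x| ≤ r) (μ : J) :
    HasMaj (BlockNorm.ofBlocks g blk) (BlockNorm.ofBlocks g blk) (mulOp (a μ ∘ ⇑(τ μ).symm)) (diagK fun _ => r) :=
  hasMaj_mulOp blk (fun _ => hr) fun _ => ha μ _

omit [Fintype X'] [DecidableEq J] in
/-- THE BY-PARTS MULTIPLIER `M_{c − Σ(∇a)∘e⁻¹} ≤ diagK (r + |J|·r₁)` from `|c| ≤ r` and the GRADIENT letter `|∇_μa_μ| ≤ r₁`. [folklore] -/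
theorem hasMaj_byPartsMult_scalar (hr : 0 ≤ r) (hr₁ : 0 ≤ r₁) (hc : ∀ x, |c x| ≤ r) (hga : ∀ μ x, |fgrad n (τ μ) (a μ) x| ≤ r₁) :
    HasMaj (BlockNorm.ofBlocks g blk) (BlockNorm.ofBlocks g blk) (mulOp (c - ∑ μ, fgrad n (τ μ) (a μ) ∘ ⇑(τ μ).symm))
      (diagK fun _ => r + Fintype.card J * r₁) := by
  refine hasMaj_mulOp blk (fun _ => by positivity) fun x => ?_
  rw [Pi.sub_apply, Finset.sum_apply]
  refine (abs_sub _ _).trans (add_le_add (hc x) ?_)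
  calc |∑ μ, (fgrad n (τ μ) (a μ) ∘ ⇑(τ μ).symm) x| ≤ ∑ μ, |(fgrad n (τ μ) (a μ) ∘ ⇑(τ μ).symm) x| := Finset.abs_sum_le_sum_abs _ _
    _ ≤ ∑ _μ : J, r₁ := Finset.sum_le_sum fun μ _ => hga μ _
    _ = Fintype.card J * r₁ := by rw [Finset.sum_const, Finset.card_univ, nsmul_eq_mul]

omit [DecidableEq J] in
/-- ITS η-DEFECT `≤ diagK (o + |J|·o)` from the fits `|c′ − c∘π| ≤ o` and `|(∇′a′)∘e′⁻¹ − ((∇a)∘e⁻¹)∘π| ≤ o`. [folklore] -/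
theorem hasMaj_idef_byPartsMult_scalar (ho : 0 ≤ o) (hfc : ∀ x', |c' x' - c (π x')| ≤ o)
    (hfg : ∀ μ x', |fgrad n' (τ' μ) (a' μ) ((τ' μ).symm x') - fgrad n (τ μ) (a μ) ((τ μ).symm (π x'))| ≤ o) :
    HasMaj (BlockNorm.ofBlocks g blk) (BlockNorm.ofBlocks g (blk ∘ π))
      (idef (pull π) (pull π) (mulOp (c' - ∑ μ, fgrad n' (τ' μ) (a' μ) ∘ ⇑(τ' μ).symm)) (mulOp (c - ∑ μ, fgrad n (τ μ) (a μ) ∘ ⇑(τ μ).symm)))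
      (diagK fun _ => o + Fintype.card J * o) := by
  refine hasMaj_idef_mulOp blk π (fun _ => by positivity) fun x' => ?_
  rw [Pi.sub_apply, Pi.sub_apply, Finset.sum_apply, Finset.sum_apply, sub_sub_sub_comm]
  refine (abs_sub _ _).trans (add_le_add (hfc x') ?_)
  rw [← Finset.sum_sub_distrib]
  calc |∑ μ, ((fgrad n' (τ' μ) (a' μ) ∘ ⇑(τ' μ).symm) x' - (fgrad n (τ μ) (a μ) ∘ ⇑(τ μ).symm) (π x'))|
      ≤ ∑ μ, |(fgrad n' (τ' μ) (a' μ) ∘ ⇑(τ' μ).symm) x' - (fgrad n (τ μ) (a μ) ∘ ⇑(τ μ).symm) (π x')| := Finset.abs_sum_le_sum_abs _ _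
    _ ≤ ∑ _μ : J, o := Finset.sum_le_sum fun μ _ => hfg μ x'
    _ = Fintype.card J * o := by rw [Finset.sum_const, Finset.card_univ, nsmul_eq_mul]

omit [Fintype J] [DecidableEq J] in
/-- THE η-DEFECT OF THE TRANSLATED COEFFICIENTS `≤ diagK o` from the translated fit `|a′(e′⁻¹x′) − a(e⁻¹(πx′))| ≤ o`. [folklore] -/
theorem hasMaj_idef_mulOp_translate (μ : J) (ho : 0 ≤ o) (hfa : ∀ x', |a' μ ((τ' μ).symm x') - a μ ((τ μ).symm (π x'))| ≤ o) :
    HasMaj (BlockNorm.ofBlocks g blk) (BlockNorm.ofBlocks g (blk ∘ π))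
      (idef (pull π) (pull π) (mulOp (a' μ ∘ ⇑(τ' μ).symm)) (mulOp (a μ ∘ ⇑(τ μ).symm))) (diagK fun _ => o) :=
  hasMaj_idef_mulOp blk π (fun _ => ho) fun x' => hfa x'

omit [Fintype X'] [Fintype J] [DecidableEq J] in
/-- the absent backward coefficient: `0 ≤ diagK r` and `𝔇(0, 0) ≤ diagK o` (`r, o ≥ 0`). [folklore] -/
theorem hasMaj_zero_diagK {X₂ : Type} [Fintype X₂] (blk₂ : X₂ → g.Site) (hr : 0 ≤ r) :
    HasMaj (BlockNorm.ofBlocks g blk) (BlockNorm.ofBlocks g blk₂) (0 : (X → ℝ) →ₗ[ℝ] (X₂ → ℝ)) (diagK fun _ => r) :=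
  (hasMaj_zero _ _).mono fun _ _ => diagK_nonneg (fun _ => hr) _ _

omit [Fintype J] [DecidableEq J] in
/-- … and the η-defect of the absent coefficient. [folklore] -/
theorem hasMaj_idef_zero_diagK (ho : 0 ≤ o) :
    HasMaj (BlockNorm.ofBlocks g blk) (BlockNorm.ofBlocks g (blk ∘ π))
      (idef (pull π) (pull π) (0 : (X' → ℝ) →ₗ[ℝ] (X' → ℝ)) (0 : (X → ℝ) →ₗ[ℝ] (X → ℝ))) (diagK fun _ => o) := by
  rw [idef_zero]
  exact hasMaj_zero_diagK blk (blk ∘ π) ho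

omit [Fintype X] [Fintype X'] [Fintype J] [DecidableEq J] in
/-- THE COARSE SHIFT INTERTWINER of the translated coefficient: `S_μ ∘ M_{a_μ∘e_μ⁻¹} = M_{a_μ} ∘ S_μ`. [folklore] -/
theorem pull_comp_mulOp_translate' (μ : J) : pull ⇑(τ μ) ∘ₗ mulOp (a μ ∘ ⇑(τ μ).symm) = mulOp (a μ) ∘ₗ pull ⇑(τ μ) :=
  pull_comp_mulOp_translate (a μ) (τ μ)

omit [Fintype X'] [Fintype J] [DecidableEq J] in
/-- THE ONE-STEP OSCILLATION LETTER: `M_{a_μ} − M_{a_μ∘e_μ⁻¹} ≤ diagK o₁` from `|a_μ(x) − a_μ(e_μ⁻¹x)| ≤ o₁` (= `r₁∕n` from the gradient letter). [folklore] -/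
theorem hasMaj_mulOp_sub_translate (μ : J) (ho₁ : 0 ≤ o₁) (hosc : ∀ x, |a μ x - a μ ((τ μ).symm x)| ≤ o₁) :
    HasMaj (BlockNorm.ofBlocks g blk) (BlockNorm.ofBlocks g blk) (mulOp (a μ) - mulOp (a μ ∘ ⇑(τ μ).symm)) (diagK fun _ => o₁) := by
  rw [← mulOp_sub]
  exact hasMaj_mulOp blk (fun _ => ho₁) fun x => hosc x

omit [Fintype X] [Fintype X'] [Fintype J] [DecidableEq J] in
/-- the one-step oscillation from the gradient letter: `|a(x) − a(e⁻¹x)| = |∇a(e⁻¹x)|∕n ≤ r₁∕n` (`n > 0`). [folklore] -/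
theorem osc_of_fgrad (μ : J) (hn : 0 < n) (hga : ∀ x, |fgrad n (τ μ) (a μ) x| ≤ r₁) (x : X) : |a μ x - a μ ((τ μ).symm x)| ≤ r₁ / n := by
  have h := hga ((τ μ).symm x)
  rw [fgrad_apply, Equiv.apply_symm_apply, abs_mul, abs_of_pos hn] at h
  rw [le_div_iff₀ hn, mul_comm]
  exact h

end Letters

end Summit.QuantumFields.YangMills.BalabanUVNodes.N15.BackgroundLayer

end
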